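import Mathlib.GroupTheory.Perm.Fin
import Mathlib.GroupTheory.Perm.Cycle.Concrete
import Mathlib.GroupTheory.Perm.Cycle.Type
import Mathlib.Data.Real.Basic
import Mathlib.Data.Fin.VecNotation
import Mathlib.Tactic.IntervalCases
import Mathlib.Tactic.FinCases
import Mathlib.Tactic.Group
import HarnessLib

/-!
# The `S₅`-dictionary for the class `(4,1)` as a one-sided inequality of permutation characters

Topic `Summits/QuantumAdvantage/QuantumAdvantage/Theorems`, cell B2b-1 (linnik-cubic), PART A (gen 8);
helper toward the crux `DegreeOnePrimesEscape` (stmt-QuantumAdvantage-11543) of route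
`LinnikCubicClassGroups`.  HONEST FRAMING: the value of this file is a THEOREM (kernel-checked finite
group theory) — NOT summit progress.

In `S₅ = Perm (Fin 5)` let `C₅ = ⟨(0 1 2 3 4)⟩`, `C₆ = ⟨(0 1 2)(3 4)⟩`, `D₅` = the dihedral group of the
pentagon.  The class function `f = 1 − Ind_{C₅}1/8 − Ind_{C₆}1/2 − Ind_{D₅}1/4` vanishes on every class
except the identity (`f(1) < 0`) and the 4-cycles (`f = 1`); its mean is `1/8 > 0` (found by a small LP,
see `…OneSidedFrobenius.lean`).  In the normal form of `exists_frobenius_mem_of_oneSided_symmetric`: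

  `8 ≤ Ind_{C₅}1 + 4·Ind_{C₆}1 + 2·Ind_{D₅}1 + 8·𝟙[#Fix(y) = 1 ∧ #Fix(y²) = 1]`   on `S₅`

(`exists_quintic41_data`; the bracket singles out the 4-cycles).  Proof: the three conjugation counts
and the fixed-point counts are class functions; every element of `S₅` is conjugate to one of seven
representatives (cycle types `∅, 2, 3, 4, 5, 2+2, 3+2` — `cycleType_cases`, from `Σ ≤ 5` and parts
`≥ 2`); at the representatives the counts are evaluated by `decide`.
-/

namespace Summit.QuantumAdvantage.QuantumAdvantage.Theorems.DegreeOnePrimesEscape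

open Equiv Equiv.Perm

/-! ### Cycle types in `S₅` -/

/-- The seven cycle types of `S₅`. -/
theorem cycleType_cases (y : Perm (Fin 5)) :
    y.cycleType = 0 ∨ y.cycleType = {2} ∨ y.cycleType = {3} ∨ y.cycleType = {4} ∨
      y.cycleType = {5} ∨ y.cycleType = {2, 2} ∨ y.cycleType = {3, 2} := by
  have hsum : y.cycleType.sum ≤ 5 := by simpa using sum_cycleType_le y
  have hge : ∀ a ∈ y.cycleType, 2 ≤ a := fun a ha => two_le_of_mem_cycleType ha
  have hcard : Multiset.card y.cycleType ≤ 2 := by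
    have h := Multiset.card_nsmul_le_sum hge
    rw [smul_eq_mul] at h
    omega
  rcases Nat.lt_or_ge (Multiset.card y.cycleType) 1 with h0 | h1
  · left
    have hc : Multiset.card y.cycleType = 0 := by omega
    exact Multiset.card_eq_zero.mp hc
  rcases Nat.lt_or_ge (Multiset.card y.cycleType) 2 with h1' | h2
  · have hc : Multiset.card y.cycleType = 1 := by omega
    obtain ⟨a, ha⟩ := Multiset.card_eq_one.mp hc
    have hmem : a ∈ y.cycleType := by rw [ha]; exact Multiset.mem_singleton_self a
    have ha2 : 2 ≤ a := hge a hmem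
    have ha5 : a ≤ 5 := le_trans (Multiset.le_sum_of_mem hmem) hsum
    rw [ha]
    interval_cases a
    · exact Or.inr (Or.inl rfl)
    · exact Or.inr (Or.inr (Or.inl rfl))
    · exact Or.inr (Or.inr (Or.inr (Or.inl rfl)))
    · exact Or.inr (Or.inr (Or.inr (Or.inr (Or.inl rfl))))
  · have hc : Multiset.card y.cycleType = 2 := by omega
    obtain ⟨a, b, hab⟩ := Multiset.card_eq_two.mp hc
    have ha : 2 ≤ a := hge a (by rw [hab]; simp)
    have hb : 2 ≤ b := hge b (by rw [hab]; simp)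
    have hs : a + b ≤ 5 := by
      have : ({a, b} : Multiset ℕ).sum = a + b := by simp
      rw [hab, this] at hsum; exact hsum
    have ha3 : a ≤ 3 := by omega
    have hb3 : b ≤ 3 := by omega
    rw [hab]
    interval_cases a <;> interval_cases b
    · exact Or.inr (Or.inr (Or.inr (Or.inr (Or.inr (Or.inl rfl)))))
    · exact Or.inr (Or.inr (Or.inr (Or.inr (Or.inr (Or.inr (Multiset.pair_comm 2 3))))))
    · exact Or.inr (Or.inr (Or.inr (Or.inr (Or.inr (Or.inr rfl)))))
    · omega

/-- Representatives of the seven classes and their cycle types. -/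
theorem exists_rep_isConj (y : Perm (Fin 5)) :
    ∃ ρ ∈ ({1, Fin.cycleRange 1, Fin.cycleRange 2, Fin.cycleRange 3, Fin.cycleRange 4,
        Fin.cycleRange 1 * Equiv.swap 3 4, Fin.cycleRange 2 * Equiv.swap 3 4} :
        Finset (Perm (Fin 5))), IsConj ρ y := by
  have h2 : (Fin.cycleRange (1 : Fin 5)).cycleType = {2} := Fin.cycleType_cycleRange (by decide)
  have h3 : (Fin.cycleRange (2 : Fin 5)).cycleType = {3} := Fin.cycleType_cycleRange (by decide)
  have h4 : (Fin.cycleRange (3 : Fin 5)).cycleType = {4} := Fin.cycleType_cycleRange (by decide)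
  have h5 : (Fin.cycleRange (4 : Fin 5)).cycleType = {5} := Fin.cycleType_cycleRange (by decide)
  have hsw : (Equiv.swap (3 : Fin 5) 4).cycleType = {2} := by
    rw [(isCycle_swap (by decide)).cycleType, card_support_swap (by decide)]
  have hd1 : Disjoint (Fin.cycleRange (1 : Fin 5)) (Equiv.swap 3 4) := by
    intro x; fin_cases x <;> decide
  have hd2 : Disjoint (Fin.cycleRange (2 : Fin 5)) (Equiv.swap 3 4) := by
    intro x; fin_cases x <;> decide
  have h22 : (Fin.cycleRange (1 : Fin 5) * Equiv.swap (3 : Fin 5) 4).cycleType = {2, 2} := by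
    rw [hd1.cycleType_mul, h2, hsw]; rfl
  have h32 : (Fin.cycleRange (2 : Fin 5) * Equiv.swap (3 : Fin 5) 4).cycleType = {3, 2} := by
    rw [hd2.cycleType_mul, h3, hsw]; rfl
  rcases cycleType_cases y with h | h | h | h | h | h | h
  · exact ⟨1, by simp, isConj_iff_cycleType_eq.mpr (by rw [cycleType_one, h])⟩
  · exact ⟨Fin.cycleRange 1, by simp, isConj_iff_cycleType_eq.mpr (by rw [h2, h])⟩
  · exact ⟨Fin.cycleRange 2, by simp, isConj_iff_cycleType_eq.mpr (by rw [h3, h])⟩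
  · exact ⟨Fin.cycleRange 3, by simp, isConj_iff_cycleType_eq.mpr (by rw [h4, h])⟩
  · exact ⟨Fin.cycleRange 4, by simp, isConj_iff_cycleType_eq.mpr (by rw [h5, h])⟩
  · exact ⟨Fin.cycleRange 1 * Equiv.swap 3 4, by simp, isConj_iff_cycleType_eq.mpr (by rw [h22, h])⟩
  · exact ⟨Fin.cycleRange 2 * Equiv.swap 3 4, by simp, isConj_iff_cycleType_eq.mpr (by rw [h32, h])⟩

/-! ### Class functions -/

/-- Conjugation counts into a fixed finset are class functions. -/
theorem card_filter_conj_mem_of_conj {n : ℕ} (F : Finset (Perm (Fin n))) (ρ c : Perm (Fin n)) :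
    (Finset.univ.filter fun q : Perm (Fin n) => q * (c * ρ * c⁻¹) * q⁻¹ ∈ F).card =
      (Finset.univ.filter fun q : Perm (Fin n) => q * ρ * q⁻¹ ∈ F).card := by
  refine Finset.card_bij (fun q _ => q * c) ?_ ?_ ?_
  · intro q hq
    rw [Finset.mem_filter] at hq ⊢
    refine ⟨Finset.mem_univ _, ?_⟩
    have : q * (c * ρ * c⁻¹) * q⁻¹ = q * c * ρ * (q * c)⁻¹ := by group
    rw [← this]; exact hq.2
  · intro q₁ _ q₂ _ h
    exact mul_right_cancel h
  · intro q hq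
    rw [Finset.mem_filter] at hq
    refine ⟨q * c⁻¹, ?_, by group⟩
    rw [Finset.mem_filter]
    refine ⟨Finset.mem_univ _, ?_⟩
    have : q * c⁻¹ * (c * ρ * c⁻¹) * (q * c⁻¹)⁻¹ = q * ρ * q⁻¹ := by group
    rw [this]; exact hq.2

/-- Fixed-point counts are class functions. -/
theorem card_filter_fixed_of_conj {n : ℕ} (ρ c : Perm (Fin n)) :
    (Finset.univ.filter fun i : Fin n => (c * ρ * c⁻¹) i = i).card =
      (Finset.univ.filter fun i : Fin n => ρ i = i).card := by
  refine Finset.card_bij (fun i _ => c⁻¹ i) ?_ ?_ ?_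
  · intro i hi
    rw [Finset.mem_filter] at hi ⊢
    refine ⟨Finset.mem_univ _, ?_⟩
    have h := hi.2
    rw [Equiv.Perm.mul_apply, Equiv.Perm.mul_apply] at h
    exact Equiv.Perm.eq_inv_iff_eq.mpr h
  · intro i _ j _ h
    exact c⁻¹.injective h
  · intro i hi
    rw [Finset.mem_filter] at hi
    refine ⟨c i, ?_, by rw [Equiv.Perm.inv_eq_iff_eq]⟩
    rw [Finset.mem_filter]
    refine ⟨Finset.mem_univ _, ?_⟩
    rw [Equiv.Perm.mul_apply, Equiv.Perm.mul_apply, Equiv.Perm.inv_eq_iff_eq.mpr rfl, hi.2]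

/-! ### The counts at the seven representatives (by `decide`) -/

set_option maxRecDepth 8000 in
/-- Conjugation counts into `C₅, C₆, D₅` and fixed points of `ρ`, `ρ²` at the representative `one`. -/
private theorem counts_one :
    (Finset.univ.filter fun q : Perm (Fin 5) => q * (1 : Perm (Fin 5)) * q⁻¹ ∈ ({1, finRotate 5, finRotate 5 ^ 2, finRotate 5 ^ 3, finRotate 5 ^ 4} : Finset (Perm (Fin 5)))).card = 120 ∧
    (Finset.univ.filter fun q : Perm (Fin 5) => q * (1 : Perm (Fin 5)) * q⁻¹ ∈ ({1, Equiv.swap (3 : Fin 5) 4, Fin.cycleRange (2 : Fin 5), Fin.cycleRange (2 : Fin 5) * Equiv.swap (3 : Fin 5) 4, Fin.cycleRange (2 : Fin 5) ^ 2, Fin.cycleRange (2 : Fin 5) ^ 2 * Equiv.swap (3 : Fin 5) 4} : Finset (Perm (Fin 5)))).card = 120 ∧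
    (Finset.univ.filter fun q : Perm (Fin 5) => q * (1 : Perm (Fin 5)) * q⁻¹ ∈ ({1, finRotate 5, finRotate 5 ^ 2, finRotate 5 ^ 3, finRotate 5 ^ 4, (Equiv.swap (1 : Fin 5) 4 * Equiv.swap (2 : Fin 5) 3), finRotate 5 * (Equiv.swap (1 : Fin 5) 4 * Equiv.swap (2 : Fin 5) 3), finRotate 5 ^ 2 * (Equiv.swap (1 : Fin 5) 4 * Equiv.swap (2 : Fin 5) 3), finRotate 5 ^ 3 * (Equiv.swap (1 : Fin 5) 4 * Equiv.swap (2 : Fin 5) 3), finRotate 5 ^ 4 * (Equiv.swap (1 : Fin 5) 4 * Equiv.swap (2 : Fin 5) 3)} : Finset (Perm (Fin 5)))).card = 120 ∧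
    (Finset.univ.filter fun i : Fin 5 => ((1 : Perm (Fin 5))) i = i).card = 5 ∧
    (Finset.univ.filter fun i : Fin 5 => ((1 : Perm (Fin 5)) ^ 2) i = i).card = 5 := by
  refine ⟨by decide, by decide, by decide, by decide, by decide⟩

set_option maxRecDepth 8000 in
/-- Conjugation counts into `C₅, C₆, D₅` and fixed points of `ρ`, `ρ²` at the representative `r2`. -/
private theorem counts_r2 :
    (Finset.univ.filter fun q : Perm (Fin 5) => q * Fin.cycleRange (1 : Fin 5) * q⁻¹ ∈ ({1, finRotate 5, finRotate 5 ^ 2, finRotate 5 ^ 3, finRotate 5 ^ 4} : Finset (Perm (Fin 5)))).card = 0 ∧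
    (Finset.univ.filter fun q : Perm (Fin 5) => q * Fin.cycleRange (1 : Fin 5) * q⁻¹ ∈ ({1, Equiv.swap (3 : Fin 5) 4, Fin.cycleRange (2 : Fin 5), Fin.cycleRange (2 : Fin 5) * Equiv.swap (3 : Fin 5) 4, Fin.cycleRange (2 : Fin 5) ^ 2, Fin.cycleRange (2 : Fin 5) ^ 2 * Equiv.swap (3 : Fin 5) 4} : Finset (Perm (Fin 5)))).card = 12 ∧
    (Finset.univ.filter fun q : Perm (Fin 5) => q * Fin.cycleRange (1 : Fin 5) * q⁻¹ ∈ ({1, finRotate 5, finRotate 5 ^ 2, finRotate 5 ^ 3, finRotate 5 ^ 4, (Equiv.swap (1 : Fin 5) 4 * Equiv.swap (2 : Fin 5) 3), finRotate 5 * (Equiv.swap (1 : Fin 5) 4 * Equiv.swap (2 : Fin 5) 3), finRotate 5 ^ 2 * (Equiv.swap (1 : Fin 5) 4 * Equiv.swap (2 : Fin 5) 3), finRotate 5 ^ 3 * (Equiv.swap (1 : Fin 5) 4 * Equiv.swap (2 : Fin 5) 3), finRotate 5 ^ 4 * (Equiv.swap (1 : Fin 5) 4 * Equiv.swap (2 :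 Fin 5) 3)} : Finset (Perm (Fin 5)))).card = 0 ∧
    (Finset.univ.filter fun i : Fin 5 => (Fin.cycleRange (1 : Fin 5)) i = i).card = 3 ∧
    (Finset.univ.filter fun i : Fin 5 => (Fin.cycleRange (1 : Fin 5) ^ 2) i = i).card = 5 := by
  refine ⟨by decide, by decide, by decide, by decide, by decide⟩

set_option maxRecDepth 8000 in
/-- Conjugation counts into `C₅, C₆, D₅` and fixed points of `ρ`, `ρ²` at the representative `r3`. -/
private theorem counts_r3 :
    (Finset.univ.filter fun q : Perm (Fin 5) => q * Fin.cycleRange (2 : Fin 5) * q⁻¹ ∈ ({1, finRotate 5, finRotate 5 ^ 2, finRotate 5 ^ 3, finRotate 5 ^ 4} : Finset (Perm (Fin 5)))).card = 0 ∧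
    (Finset.univ.filter fun q : Perm (Fin 5) => q * Fin.cycleRange (2 : Fin 5) * q⁻¹ ∈ ({1, Equiv.swap (3 : Fin 5) 4, Fin.cycleRange (2 : Fin 5), Fin.cycleRange (2 : Fin 5) * Equiv.swap (3 : Fin 5) 4, Fin.cycleRange (2 : Fin 5) ^ 2, Fin.cycleRange (2 : Fin 5) ^ 2 * Equiv.swap (3 : Fin 5) 4} : Finset (Perm (Fin 5)))).card = 12 ∧
    (Finset.univ.filter fun q : Perm (Fin 5) => q * Fin.cycleRange (2 : Fin 5) * q⁻¹ ∈ ({1, finRotate 5, finRotate 5 ^ 2, finRotate 5 ^ 3, finRotate 5 ^ 4, (Equiv.swap (1 : Fin 5) 4 * Equiv.swap (2 : Fin 5) 3), finRotate 5 * (Equiv.swap (1 : Fin 5) 4 * Equiv.swap (2 : Fin 5) 3), finRotate 5 ^ 2 * (Equiv.swap (1 : Fin 5) 4 * Equiv.swap (2 : Fin 5) 3), finRotate 5 ^ 3 * (Equiv.swap (1 : Fin 5) 4 * Equiv.swap (2 : Fin 5) 3), finRotate 5 ^ 4 * (Equiv.swap (1 : Fin 5) 4 * Equiv.swap (2 :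 Fin 5) 3)} : Finset (Perm (Fin 5)))).card = 0 ∧
    (Finset.univ.filter fun i : Fin 5 => (Fin.cycleRange (2 : Fin 5)) i = i).card = 2 ∧
    (Finset.univ.filter fun i : Fin 5 => (Fin.cycleRange (2 : Fin 5) ^ 2) i = i).card = 2 := by
  refine ⟨by decide, by decide, by decide, by decide, by decide⟩

set_option maxRecDepth 8000 in
/-- Conjugation counts into `C₅, C₆, D₅` and fixed points of `ρ`, `ρ²` at the representative `r4`. -/
private theorem counts_r4 :
    (Finset.univ.filter fun q : Perm (Fin 5) => q * Fin.cycleRange (3 : Fin 5) * q⁻¹ ∈ ({1, finRotate 5, finRotate 5 ^ 2, finRotate 5 ^ 3, finRotate 5 ^ 4} : Finset (Perm (Fin 5)))).card = 0 ∧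
    (Finset.univ.filter fun q : Perm (Fin 5) => q * Fin.cycleRange (3 : Fin 5) * q⁻¹ ∈ ({1, Equiv.swap (3 : Fin 5) 4, Fin.cycleRange (2 : Fin 5), Fin.cycleRange (2 : Fin 5) * Equiv.swap (3 : Fin 5) 4, Fin.cycleRange (2 : Fin 5) ^ 2, Fin.cycleRange (2 : Fin 5) ^ 2 * Equiv.swap (3 : Fin 5) 4} : Finset (Perm (Fin 5)))).card = 0 ∧
    (Finset.univ.filter fun q : Perm (Fin 5) => q * Fin.cycleRange (3 : Fin 5) * q⁻¹ ∈ ({1, finRotate 5, finRotate 5 ^ 2, finRotate 5 ^ 3, finRotate 5 ^ 4, (Equiv.swap (1 : Fin 5) 4 * Equiv.swap (2 : Fin 5) 3), finRotate 5 * (Equiv.swap (1 : Fin 5) 4 * Equiv.swap (2 : Fin 5) 3), finRotate 5 ^ 2 * (Equiv.swap (1 : Fin 5) 4 * Equiv.swap (2 : Fin 5) 3), finRotate 5 ^ 3 * (Equiv.swap (1 : Fin 5) 4 * Equiv.swap (2 : Fin 5) 3), finRotate 5 ^ 4 * (Equiv.swap (1 : Fin 5) 4 * Equiv.swap (2 :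 Fin 5) 3)} : Finset (Perm (Fin 5)))).card = 0 ∧
    (Finset.univ.filter fun i : Fin 5 => (Fin.cycleRange (3 : Fin 5)) i = i).card = 1 ∧
    (Finset.univ.filter fun i : Fin 5 => (Fin.cycleRange (3 : Fin 5) ^ 2) i = i).card = 1 := by
  refine ⟨by decide, by decide, by decide, by decide, by decide⟩

set_option maxRecDepth 8000 in
/-- Conjugation counts into `C₅, C₆, D₅` and fixed points of `ρ`, `ρ²` at the representative `r5`. -/
private theorem counts_r5 :
    (Finset.univ.filter fun q : Perm (Fin 5) => q * Fin.cycleRange (4 : Fin 5) * q⁻¹ ∈ ({1, finRotate 5, finRotate 5 ^ 2, finRotate 5 ^ 3, finRotate 5 ^ 4} : Finset (Perm (Fin 5)))).card = 20 ∧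
    (Finset.univ.filter fun q : Perm (Fin 5) => q * Fin.cycleRange (4 : Fin 5) * q⁻¹ ∈ ({1, Equiv.swap (3 : Fin 5) 4, Fin.cycleRange (2 : Fin 5), Fin.cycleRange (2 : Fin 5) * Equiv.swap (3 : Fin 5) 4, Fin.cycleRange (2 : Fin 5) ^ 2, Fin.cycleRange (2 : Fin 5) ^ 2 * Equiv.swap (3 : Fin 5) 4} : Finset (Perm (Fin 5)))).card = 0 ∧
    (Finset.univ.filter fun q : Perm (Fin 5) => q * Fin.cycleRange (4 : Fin 5) * q⁻¹ ∈ ({1, finRotate 5, finRotate 5 ^ 2, finRotate 5 ^ 3, finRotate 5 ^ 4, (Equiv.swap (1 : Fin 5) 4 * Equiv.swap (2 : Fin 5) 3), finRotate 5 * (Equiv.swap (1 : Fin 5) 4 * Equiv.swap (2 : Fin 5) 3), finRotate 5 ^ 2 * (Equiv.swap (1 : Fin 5) 4 * Equiv.swap (2 : Fin 5) 3), finRotate 5 ^ 3 * (Equiv.swap (1 : Fin 5) 4 * Equiv.swap (2 : Fin 5) 3), finRotate 5 ^ 4 * (Equiv.swap (1 : Fin 5) 4 * Equiv.swap (2 :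 Fin 5) 3)} : Finset (Perm (Fin 5)))).card = 20 ∧
    (Finset.univ.filter fun i : Fin 5 => (Fin.cycleRange (4 : Fin 5)) i = i).card = 0 ∧
    (Finset.univ.filter fun i : Fin 5 => (Fin.cycleRange (4 : Fin 5) ^ 2) i = i).card = 0 := by
  refine ⟨by decide, by decide, by decide, by decide, by decide⟩

set_option maxRecDepth 8000 in
/-- Conjugation counts into `C₅, C₆, D₅` and fixed points of `ρ`, `ρ²` at the representative `r22`. -/
private theorem counts_r22 :
    (Finset.univ.filter fun q : Perm (Fin 5) => q * (Fin.cycleRange (1 : Fin 5) * Equiv.swap (3 : Fin 5) 4) * q⁻¹ ∈ ({1, finRotate 5, finRotate 5 ^ 2, finRotate 5 ^ 3, finRotate 5 ^ 4} : Finset (Perm (Fin 5)))).card = 0 ∧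
    (Finset.univ.filter fun q : Perm (Fin 5) => q * (Fin.cycleRange (1 : Fin 5) * Equiv.swap (3 : Fin 5) 4) * q⁻¹ ∈ ({1, Equiv.swap (3 : Fin 5) 4, Fin.cycleRange (2 : Fin 5), Fin.cycleRange (2 : Fin 5) * Equiv.swap (3 : Fin 5) 4, Fin.cycleRange (2 : Fin 5) ^ 2, Fin.cycleRange (2 : Fin 5) ^ 2 * Equiv.swap (3 : Fin 5) 4} : Finset (Perm (Fin 5)))).card = 0 ∧
    (Finset.univ.filter fun q : Perm (Fin 5) => q * (Fin.cycleRange (1 : Fin 5) * Equiv.swap (3 : Fin 5) 4) * q⁻¹ ∈ ({1, finRotate 5, finRotate 5 ^ 2, finRotate 5 ^ 3, finRotate 5 ^ 4, (Equiv.swap (1 : Fin 5) 4 * Equiv.swap (2 : Fin 5) 3), finRotate 5 * (Equiv.swap (1 : Fin 5) 4 * Equiv.swap (2 : Fin 5) 3), finRotate 5 ^ 2 * (Equiv.swap (1 : Fin 5) 4 * Equiv.swap (2 : Fin 5) 3), finRotate 5 ^ 3 * (Equiv.swap (1 : Fin 5) 4 * Equiv.swap (2 : Fin 5) 3), finRotate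 5 ^ 4 * (Equiv.swap (1 : Fin 5) 4 * Equiv.swap (2 : Fin 5) 3)} : Finset (Perm (Fin 5)))).card = 40 ∧
    (Finset.univ.filter fun i : Fin 5 => ((Fin.cycleRange (1 : Fin 5) * Equiv.swap (3 : Fin 5) 4)) i = i).card = 1 ∧
    (Finset.univ.filter fun i : Fin 5 => ((Fin.cycleRange (1 : Fin 5) * Equiv.swap (3 : Fin 5) 4) ^ 2) i = i).card = 5 := by
  refine ⟨by decide, by decide, by decide, by decide, by decide⟩

set_option maxRecDepth 8000 in
/-- Conjugation counts into `C₅, C₆, D₅` and fixed points of `ρ`, `ρ²` at the representative `r32`. -/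
private theorem counts_r32 :
    (Finset.univ.filter fun q : Perm (Fin 5) => q * (Fin.cycleRange (2 : Fin 5) * Equiv.swap (3 : Fin 5) 4) * q⁻¹ ∈ ({1, finRotate 5, finRotate 5 ^ 2, finRotate 5 ^ 3, finRotate 5 ^ 4} : Finset (Perm (Fin 5)))).card = 0 ∧
    (Finset.univ.filter fun q : Perm (Fin 5) => q * (Fin.cycleRange (2 : Fin 5) * Equiv.swap (3 : Fin 5) 4) * q⁻¹ ∈ ({1, Equiv.swap (3 : Fin 5) 4, Fin.cycleRange (2 : Fin 5), Fin.cycleRange (2 : Fin 5) * Equiv.swap (3 : Fin 5) 4, Fin.cycleRange (2 : Fin 5) ^ 2, Fin.cycleRange (2 : Fin 5) ^ 2 * Equiv.swap (3 : Fin 5) 4} : Finset (Perm (Fin 5)))).card = 12 ∧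
    (Finset.univ.filter fun q : Perm (Fin 5) => q * (Fin.cycleRange (2 : Fin 5) * Equiv.swap (3 : Fin 5) 4) * q⁻¹ ∈ ({1, finRotate 5, finRotate 5 ^ 2, finRotate 5 ^ 3, finRotate 5 ^ 4, (Equiv.swap (1 : Fin 5) 4 * Equiv.swap (2 : Fin 5) 3), finRotate 5 * (Equiv.swap (1 : Fin 5) 4 * Equiv.swap (2 : Fin 5) 3), finRotate 5 ^ 2 * (Equiv.swap (1 : Fin 5) 4 * Equiv.swap (2 : Fin 5) 3), finRotate 5 ^ 3 * (Equiv.swap (1 : Fin 5) 4 * Equiv.swap (2 : Fin 5) 3), finRotate 5 ^ 4 * (Equiv.swap (1 : Fin 5) 4 * Equiv.swap (2 : Fin 5) 3)} : Finset (Perm (Fin 5)))).card = 0 ∧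
    (Finset.univ.filter fun i : Fin 5 => ((Fin.cycleRange (2 : Fin 5) * Equiv.swap (3 : Fin 5) 4)) i = i).card = 0 ∧
    (Finset.univ.filter fun i : Fin 5 => ((Fin.cycleRange (2 : Fin 5) * Equiv.swap (3 : Fin 5) 4) ^ 2) i = i).card = 2 := by
  refine ⟨by decide, by decide, by decide, by decide, by decide⟩

set_option maxRecDepth 8000 in
/-- `C5` is a subgroup of order `5` (closure checked by `decide`). -/
private theorem closed_C5 :
    (1 : Perm (Fin 5)) ∈ ({1, finRotate 5, finRotate 5 ^ 2, finRotate 5 ^ 3, finRotate 5 ^ 4} : Finset (Perm (Fin 5))) ∧ (∀ a ∈ ({1, finRotate 5, finRotate 5 ^ 2, finRotate 5 ^ 3, finRotate 5 ^ 4} : Finset (Perm (Fin 5))), ∀ b ∈ ({1, finRotate 5, finRotate 5 ^ 2, finRotate 5 ^ 3, finRotate 5 ^ 4} : Finset (Perm (Fin 5))), a * b ∈ ({1, finRotate 5, finRotate 5 ^ 2, finRotate 5 ^ 3, finRotate 5 ^ 4} : Finset (Perm (Fin 5)))) ∧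
    (∀ a ∈ ({1, finRotate 5, finRotate 5 ^ 2, finRotate 5 ^ 3, finRotate 5 ^ 4} : Finset (Perm (Fin 5))), a⁻¹ ∈ ({1, finRotate 5, finRotate 5 ^ 2, finRotate 5 ^ 3, finRotate 5 ^ 4} : Finset (Perm (Fin 5)))) ∧ (({1, finRotate 5, finRotate 5 ^ 2, finRotate 5 ^ 3, finRotate 5 ^ 4} : Finset (Perm (Fin 5)))).card = 5 := by
  refine ⟨by decide, by decide, by decide, by decide⟩

set_option maxRecDepth 8000 in
/-- `C6` is a subgroup of order `6` (closure checked by `decide`). -/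
private theorem closed_C6 :
    (1 : Perm (Fin 5)) ∈ ({1, Equiv.swap (3 : Fin 5) 4, Fin.cycleRange (2 : Fin 5), Fin.cycleRange (2 : Fin 5) * Equiv.swap (3 : Fin 5) 4, Fin.cycleRange (2 : Fin 5) ^ 2, Fin.cycleRange (2 : Fin 5) ^ 2 * Equiv.swap (3 : Fin 5) 4} : Finset (Perm (Fin 5))) ∧ (∀ a ∈ ({1, Equiv.swap (3 : Fin 5) 4, Fin.cycleRange (2 : Fin 5), Fin.cycleRange (2 : Fin 5) * Equiv.swap (3 : Fin 5) 4, Fin.cycleRange (2 : Fin 5) ^ 2, Fin.cycleRange (2 : Fin 5) ^ 2 * Equiv.swap (3 : Fin 5) 4} : Finset (Perm (Fin 5))), ∀ b ∈ ({1, Equiv.swap (3 : Fin 5) 4, Fin.cycleRange (2 : Fin 5), Fin.cycleRange (2 : Fin 5) * Equiv.swap (3 : Fin 5) 4, Fin.cycleRange (2 : Fin 5) ^ 2, Fin.cycleRange (2 : Fin 5) ^ 2 * Equiv.swap (3 : Fin 5) 4} : Finset (Perm (Fin 5))), a * b ∈ ({1, Equiv.swap (3 : Fin 5) 4, Fin.cycleRange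 (2 : Fin 5), Fin.cycleRange (2 : Fin 5) * Equiv.swap (3 : Fin 5) 4, Fin.cycleRange (2 : Fin 5) ^ 2, Fin.cycleRange (2 : Fin 5) ^ 2 * Equiv.swap (3 : Fin 5) 4} : Finset (Perm (Fin 5)))) ∧
    (∀ a ∈ ({1, Equiv.swap (3 : Fin 5) 4, Fin.cycleRange (2 : Fin 5), Fin.cycleRange (2 : Fin 5) * Equiv.swap (3 : Fin 5) 4, Fin.cycleRange (2 : Fin 5) ^ 2, Fin.cycleRange (2 : Fin 5) ^ 2 * Equiv.swap (3 : Fin 5) 4} : Finset (Perm (Fin 5))), a⁻¹ ∈ ({1, Equiv.swap (3 : Fin 5) 4, Fin.cycleRange (2 : Fin 5), Fin.cycleRange (2 : Fin 5) * Equiv.swap (3 : Fin 5) 4, Fin.cycleRange (2 : Fin 5) ^ 2, Fin.cycleRange (2 : Fin 5) ^ 2 * Equiv.swap (3 : Fin 5) 4} : Finset (Perm (Fin 5)))) ∧ (({1, Equiv.swap (3 : Fin 5) 4, Fin.cycleRange (2 : Fin 5), Fin.cycleRange (2 : Fin 5) * Equiv.swap (3 : Fin 5) 4, Fin.cycleRange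 (2 : Fin 5) ^ 2, Fin.cycleRange (2 : Fin 5) ^ 2 * Equiv.swap (3 : Fin 5) 4} : Finset (Perm (Fin 5)))).card = 6 := by
  refine ⟨by decide, by decide, by decide, by decide⟩

set_option maxRecDepth 8000 in
/-- `D5` is a subgroup of order `10` (closure checked by `decide`). -/
private theorem closed_D5 :
    (1 : Perm (Fin 5)) ∈ ({1, finRotate 5, finRotate 5 ^ 2, finRotate 5 ^ 3, finRotate 5 ^ 4, (Equiv.swap (1 : Fin 5) 4 * Equiv.swap (2 : Fin 5) 3), finRotate 5 * (Equiv.swap (1 : Fin 5) 4 * Equiv.swap (2 : Fin 5) 3), finRotate 5 ^ 2 * (Equiv.swap (1 : Fin 5) 4 * Equiv.swap (2 : Fin 5) 3), finRotate 5 ^ 3 * (Equiv.swap (1 : Fin 5) 4 * Equiv.swap (2 : Fin 5) 3), finRotate 5 ^ 4 * (Equiv.swap (1 : Fin 5) 4 * Equiv.swap (2 : Fin 5) 3)} : Finset (Perm (Fin 5))) ∧ (∀ a ∈ ({1, finRotate 5, finRotate 5 ^ 2, finRotate 5 ^ 3, finRotate 5 ^ 4, (Equiv.swap (1 : Fin 5)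 4 * Equiv.swap (2 : Fin 5) 3), finRotate 5 * (Equiv.swap (1 : Fin 5) 4 * Equiv.swap (2 : Fin 5) 3), finRotate 5 ^ 2 * (Equiv.swap (1 : Fin 5) 4 * Equiv.swap (2 : Fin 5) 3), finRotate 5 ^ 3 * (Equiv.swap (1 : Fin 5) 4 * Equiv.swap (2 : Fin 5) 3), finRotate 5 ^ 4 * (Equiv.swap (1 : Fin 5) 4 * Equiv.swap (2 : Fin 5) 3)} : Finset (Perm (Fin 5))), ∀ b ∈ ({1, finRotate 5, finRotate 5 ^ 2, finRotate 5 ^ 3, finRotate 5 ^ 4, (Equiv.swap (1 : Fin 5) 4 * Equiv.swap (2 : Fin 5) 3), finRotate 5 * (Equiv.swap (1 : Fin 5) 4 * Equiv.swap (2 : Fin 5) 3), finRotate 5 ^ 2 * (Equiv.swap (1 : Fin 5) 4 * Equiv.swap (2 : Fin 5) 3), finRotate 5 ^ 3 * (Equiv.swap (1 : Fin 5) 4 * Equiv.swap (2 : Fin 5) 3), finRotate 5 ^ 4 * (Equiv.swap (1 : Fin 5) 4 * Equiv.swap (2 : Fin 5) 3)} : Finset (Perm (Fin 5))), a * b ∈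 ({1, finRotate 5, finRotate 5 ^ 2, finRotate 5 ^ 3, finRotate 5 ^ 4, (Equiv.swap (1 : Fin 5) 4 * Equiv.swap (2 : Fin 5) 3), finRotate 5 * (Equiv.swap (1 : Fin 5) 4 * Equiv.swap (2 : Fin 5) 3), finRotate 5 ^ 2 * (Equiv.swap (1 : Fin 5) 4 * Equiv.swap (2 : Fin 5) 3), finRotate 5 ^ 3 * (Equiv.swap (1 : Fin 5) 4 * Equiv.swap (2 : Fin 5) 3), finRotate 5 ^ 4 * (Equiv.swap (1 : Fin 5) 4 * Equiv.swap (2 : Fin 5) 3)} : Finset (Perm (Fin 5)))) ∧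
    (∀ a ∈ ({1, finRotate 5, finRotate 5 ^ 2, finRotate 5 ^ 3, finRotate 5 ^ 4, (Equiv.swap (1 : Fin 5) 4 * Equiv.swap (2 : Fin 5) 3), finRotate 5 * (Equiv.swap (1 : Fin 5) 4 * Equiv.swap (2 : Fin 5) 3), finRotate 5 ^ 2 * (Equiv.swap (1 : Fin 5) 4 * Equiv.swap (2 : Fin 5) 3), finRotate 5 ^ 3 * (Equiv.swap (1 : Fin 5) 4 * Equiv.swap (2 : Fin 5) 3), finRotate 5 ^ 4 * (Equiv.swap (1 : Fin 5) 4 * Equiv.swap (2 : Fin 5) 3)} : Finset (Perm (Fin 5))), a⁻¹ ∈ ({1, finRotate 5, finRotate 5 ^ 2, finRotate 5 ^ 3, finRotate 5 ^ 4, (Equiv.swap (1 : Fin 5) 4 * Equiv.swap (2 : Fin 5) 3), finRotate 5 * (Equiv.swap (1 : Fin 5) 4 * Equiv.swap (2 : Fin 5) 3), finRotate 5 ^ 2 * (Equiv.swap (1 : Fin 5) 4 * Equiv.swap (2 : Fin 5) 3), finRotate 5 ^ 3 * (Equiv.swap (1 : Fin 5) 4 * Equiv.swap (2 : Fin 5)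 3), finRotate 5 ^ 4 * (Equiv.swap (1 : Fin 5) 4 * Equiv.swap (2 : Fin 5) 3)} : Finset (Perm (Fin 5)))) ∧ (({1, finRotate 5, finRotate 5 ^ 2, finRotate 5 ^ 3, finRotate 5 ^ 4, (Equiv.swap (1 : Fin 5) 4 * Equiv.swap (2 : Fin 5) 3), finRotate 5 * (Equiv.swap (1 : Fin 5) 4 * Equiv.swap (2 : Fin 5) 3), finRotate 5 ^ 2 * (Equiv.swap (1 : Fin 5) 4 * Equiv.swap (2 : Fin 5) 3), finRotate 5 ^ 3 * (Equiv.swap (1 : Fin 5) 4 * Equiv.swap (2 : Fin 5) 3), finRotate 5 ^ 4 * (Equiv.swap (1 : Fin 5) 4 * Equiv.swap (2 : Fin 5) 3)} : Finset (Perm (Fin 5)))).card = 10 := by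
  refine ⟨by decide, by decide, by decide, by decide⟩

/-! ### Assembly -/

/-- From a finset closed under the group operations to a subgroup with the same membership. -/
private theorem exists_subgroup_of_closed (F : Finset (Perm (Fin 5))) (h1 : (1 : Perm (Fin 5)) ∈ F)
    (hmul : ∀ a ∈ F, ∀ b ∈ F, a * b ∈ F) (hinv : ∀ a ∈ F, a⁻¹ ∈ F) :
    ∃ S : Subgroup (Perm (Fin 5)), Nat.card S = F.card ∧
      ∀ y : Perm (Fin 5), Nat.card {q : Perm (Fin 5) // q * y * q⁻¹ ∈ S} =
        (Finset.univ.filter fun q : Perm (Fin 5) => q * y * q⁻¹ ∈ F).card := by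
  classical
  let S : Subgroup (Perm (Fin 5)) :=
    { carrier := {σ | σ ∈ F}
      mul_mem' := fun {a} {b} ha hb => hmul a ha b hb
      one_mem' := h1
      inv_mem' := fun {a} ha => hinv a ha }
  refine ⟨S, ?_, fun y => ?_⟩
  · have e : S ≃ {q : Perm (Fin 5) // q ∈ F} := Equiv.subtypeEquivRight (fun q => Iff.rfl)
    rw [Nat.card_congr e, Nat.card_eq_fintype_card, Fintype.card_coe]
  · have e : {q : Perm (Fin 5) // q * y * q⁻¹ ∈ S} ≃ {q : Perm (Fin 5) // q * y * q⁻¹ ∈ F} :=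
      Equiv.subtypeEquivRight (fun q => Iff.rfl)
    rw [Nat.card_congr e, Nat.card_eq_fintype_card, Fintype.card_subtype]

set_option maxHeartbeats 800000 in
/-- **The one-sided `S₅`-data for the class `(4,1)`.** There are proper subgroups `H₀,…,H₆` of `S₅`
(`C₅; C₆ ×4; D₅ ×2`) such that for every `y ∈ S₅`:
`8 ≤ Σ_i Ind_{H_i} 1 (y) + 8·𝟙[#Fix(y) = 1 ∧ #Fix(y²) = 1]`. -/
theorem exists_quintic41_data :
    ∃ H : Fin 7 → Subgroup (Perm (Fin 5)), (∀ i, H i ≠ ⊤) ∧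
      ∀ y : Perm (Fin 5), (8 : ℝ) ≤
        ∑ i, (Nat.card {q : Perm (Fin 5) // q * y * q⁻¹ ∈ H i} : ℝ) / Nat.card (H i) +
          (if (Finset.univ.filter fun i : Fin 5 => y i = i).card = 1 ∧
              (Finset.univ.filter fun i : Fin 5 => (y ^ 2) i = i).card = 1 then (8 : ℝ) else 0) := by
  classical
  obtain ⟨h5one, h5mul, h5inv, h5card⟩ := closed_C5
  obtain ⟨h6one, h6mul, h6inv, h6card⟩ := closed_C6
  obtain ⟨h10one, h10mul, h10inv, h10card⟩ := closed_D5
  obtain ⟨S5, hS5card, hS5c⟩ := exists_subgroup_of_closed _ h5one h5mul h5inv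
  obtain ⟨S6, hS6card, hS6c⟩ := exists_subgroup_of_closed _ h6one h6mul h6inv
  obtain ⟨S10, hS10card, hS10c⟩ := exists_subgroup_of_closed _ h10one h10mul h10inv
  rw [h5card] at hS5card
  rw [h6card] at hS6card
  rw [h10card] at hS10card
  have htop : Nat.card (⊤ : Subgroup (Perm (Fin 5))) = 120 := by
    rw [Subgroup.card_top, Nat.card_eq_fintype_card, Fintype.card_perm, Fintype.card_fin]; rfl
  have hne : ∀ S : Subgroup (Perm (Fin 5)), Nat.card S ≠ 120 → S ≠ ⊤ := by
    intro S hS h; exact hS (by rw [h, htop])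
  -- the family `(C₅, C₆, C₆, C₆, C₆, D₅, D₅)`
  let H : Fin 7 → Subgroup (Perm (Fin 5)) := fun i =>
    if i.val = 0 then S5 else if i.val ≤ 4 then S6 else S10
  have hH : ∀ i, H i = S5 ∨ H i = S6 ∨ H i = S10 := by
    intro i
    show (if i.val = 0 then S5 else if i.val ≤ 4 then S6 else S10) = S5 ∨
      (if i.val = 0 then S5 else if i.val ≤ 4 then S6 else S10) = S6 ∨
      (if i.val = 0 then S5 else if i.val ≤ 4 then S6 else S10) = S10
    split_ifs
    · exact Or.inl rfl
    · exact Or.inr (Or.inl rfl)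
    · exact Or.inr (Or.inr rfl)
  refine ⟨H, fun i => ?_, fun y => ?_⟩
  · rcases hH i with h | h | h <;> rw [h]
    · exact hne S5 (by rw [hS5card]; norm_num)
    · exact hne S6 (by rw [hS6card]; norm_num)
    · exact hne S10 (by rw [hS10card]; norm_num)
  · -- expand the sum over `Fin 7`
    have h0 : H 0 = S5 := rfl
    have h1 : H 1 = S6 := rfl
    have h2 : H 2 = S6 := rfl
    have h3 : H 3 = S6 := rfl
    have h4 : H 4 = S6 := rfl
    have h5 : H 5 = S10 := rfl
    have h6 : H 6 = S10 := rfl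
    rw [Fin.sum_univ_seven, h0, h1, h2, h3, h4, h5, h6, hS5card, hS6card, hS10card, hS5c, hS6c, hS10c]
    -- reduce to a representative
    obtain ⟨ρ, hρ, hconj⟩ := exists_rep_isConj y
    obtain ⟨c, hc⟩ := isConj_iff.mp hconj
    subst hc
    rw [card_filter_conj_mem_of_conj, card_filter_conj_mem_of_conj, card_filter_conj_mem_of_conj,
      conj_pow, card_filter_fixed_of_conj, card_filter_fixed_of_conj]
    simp only [Finset.mem_insert, Finset.mem_singleton] at hρ
    rcases hρ with rfl | rfl | rfl | rfl | rfl | rfl | rfl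
    · obtain ⟨e1, e2, e3, e4, e5⟩ := counts_one
      rw [e1, e2, e3, e4, e5]; norm_num
    · obtain ⟨e1, e2, e3, e4, e5⟩ := counts_r2
      rw [e1, e2, e3, e4, e5]; norm_num
    · obtain ⟨e1, e2, e3, e4, e5⟩ := counts_r3
      rw [e1, e2, e3, e4, e5]; norm_num
    · obtain ⟨e1, e2, e3, e4, e5⟩ := counts_r4
      rw [e1, e2, e3, e4, e5]; norm_num
    · obtain ⟨e1, e2, e3, e4, e5⟩ := counts_r5
      rw [e1, e2, e3, e4, e5]; norm_num
    · obtain ⟨e1, e2, e3, e4, e5⟩ := counts_r22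
      rw [e1, e2, e3, e4, e5]; norm_num
    · obtain ⟨e1, e2, e3, e4, e5⟩ := counts_r32
      rw [e1, e2, e3, e4, e5]; norm_num

end Summit.QuantumAdvantage.QuantumAdvantage.Theorems.DegreeOnePrimesEscape
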